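/-
Copyright (c) 2026 the pub-hodgecm-mathlib formalisation cell (harness21).  Prover seat hodgecm-mathlib-LH4-p01 (g0): line LH4, SHALIKA pay-down (dealer LH4-plan (g2)
04:17:40Z, organ SPAN-c «U3-STRATA»; skeleton cand `StubN6nsShalika.paydown.skeleton.v1` a42538b59ca1b043 :97–:99 setting); 2026-09-02.
-/
import Literature.NumberTheory.Automorphic.UnitaryThreeTransvectionClassOpen                  -- ★ (this seat): `exists_isOpen_transvection_class`, `isClosed_setOf_coe_sub_one_pow_eq_zero` (matrix half)
import Literature.NumberTheory.Rogawski1990.UnipotentLevelPiecesFrameCM                 -- ★ the CM frame `ψ = T·e(·)·T⁻¹` (class ∕ unipotency transport, continuity); brings ★ `localNonsplitEquiv`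
import Literature.NumberTheory.Automorphic.LocalUnitaryIntegralLevel                        -- ★ `placeForm_antidiagOne`
import Literature.NumberTheory.Automorphic.UnitaryGroupFormCongrFinSum                      -- ★ `formCongr_one_eq`
import Literature.NumberTheory.Rogawski1990.UnitaryVertexStabilizerCoverCM                  -- ★ `galAdicCompletionMap_involutive`
import Literature.NumberTheory.Rogawski1990.ExplicitFactorKappaAlmostEverywhereOne          -- ★ `smul_placesOver_eq_of_subsingleton`
import Literature.RingTheory.DiscreteValuationRing.AdicCompletionHensel                     -- ★ `adicCompletionIntegers.henselianLocalRing`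
import HarnessLib

/-!
# The unipotent variety of `U(Φ₃)(L⁺_v)` at an ODD non-split place: CLOSED STRATA `{(γ−1)^k = 0}` and each unipotent class OPEN IN ITS STRATUM, hence LOCALLY CLOSED
# (Rogawski 1990 §3.9 Prop. 3.9.1; Bernstein–Zelevinsky 1976 §1.5)

Topic `NumberTheory/Rogawski1990`; namespace `Literature.NumberTheory.Rogawski1990`.  THEOREMS ONLY (no definition, no instance, no notation, no named fact, no `sorry`);
kernel lane `--supports stmt-HodgeConjecture-24833`.  Cell `pub/hodgecm-mathlib` (D-0151), crux H413 = `stmt-HodgeConjecture-24833`; line LH4, the SHALIKA pay-down of the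
print row `stub_N6nsShalika` ([Rogawski1990, Prop. 8.1.1] at `U(Φ₃)(L⁺_v)`, odd non-split places; LH4-plan (g2) memo `LH4-SHALIKA-LINE.v1` c57a22003299b6e9 §3, skeleton cand
`StubN6nsShalika.paydown.skeleton.v1` a42538b59ca1b043), organ **SPAN-c «U3-STRATA»** (dealer LH4-plan (g2) 2026-09-02T04:17:40Z): the input of the Howe-span induction
(SPAN-e) along the closure stratification `{1} ⊂ {(γ−1)² = 0} ⊂ {(γ−1)³ = 0}` of the unipotent variety, and the hypothesis `IsLocallyClosed 𝒪(u)` of the locally-closed-orbit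
embedding (SPAN-b).

SETTING (skeleton a42538b5 :97–:99 verbatim): a CM field `L`, a finite place `v` of `L⁺` with `w ∣ v`, `Subsingleton (PlacesOver L v)` (non-split) and `2 ∈ 𝒪_w^×` (odd);
`G = (cmDatum L 3 Φ₃).Local v = U(Φ₃)(L⁺_v)`, `Φ₃ = antidiag(1,1,1)`; `n(γ) := (γ : GL₃(L ⊗ L⁺_v)) − 1`.

THE MATHEMATICS.  Along the one-place model `ψ = e : G ≃ₜ* U(σ_w, J₀)(L_w)` (★ `localNonsplitEquiv`; the frame of ★ `UnipotentLevelPiecesFrameCM` at `T = 1`, since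
`(Φ₃)_w = J₀`) the three unipotent strata of [Rogawski1990, §3.9] read: order 3 — the REGULAR unipotents, ONE class when `2 ≠ 0` (Prop. 3.9.1, ★ `exists_conj_eq_of_regular_unipotent`);
order 2 — the transvections, each conjugate to some `n(t) = 1 + t·E₀₂`, `t ∈ E⁰ ∖ 0` (★ `exists_conj_coe_eq_cornerUnipotent_of_sq_eq_zero`), with `[n(t)] = [n(t′)] ⟺ t′ ∈ t·N(L_w^×)`
(★ `exists_conj_eq_iff_exists_norm_mul`) and INVARIANT the value set `{B₀(x, (g − 1)x)} = t·N(L_w)` (★ `range_B₀_conj_sub_one_mulVec`); order 1 — `{1}`.  The new point is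
TOPOLOGICAL: the norm class of the invariant is LOCALLY CONSTANT on the transvection stratum, because at odd residue characteristic a `σ_w`-fixed principal unit `a`
(`|a − 1| < 1`) is a NORM — Hensel (`𝒪_w` is Henselian, ★ `adicCompletionIntegers.henselianLocalRing`) lifts `1` to `b` with `b² = a`, `|b − 1| < 1`, and `σ b = b` (else
`|σ b − 1| = |b + 1| = |2| = 1`), so `a = b·σb`.  Hence `V := {g | ∃ x, |B₀(x, (g−1)x) − t| < |t|}` is an OPEN subset of `GL₃(L_w)` containing the class of `n(t)` and meeting
the transvection stratum exactly in that class; pulled back along the continuous `ψ` it cuts the class out of its stratum in `G`.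

* matrix half (any valued field `K` with Henselian `𝒪`, isometric involution `σ`, `|2| = 1`) = ★ `Automorphic/UnitaryThreeTransvectionClassOpen` (this seat):
  **`exists_isOpen_transvection_class`**, `isClosed_setOf_coe_sub_one_pow_eq_zero`;
* §2 (transport, `T = 1`): `placeForm_antidiagOne_eq_formCongr_one`, `continuous_conj_localNonsplitEquiv_one`, `sub_one_pow_eq_zero_iff_conj_localNonsplitEquiv` (BOTH ways —
  one place above `v`), `conj_localNonsplitEquiv_eq_one_iff`, `isConj_iff_exists_conj_localNonsplitEquiv`, `sub_one_pow_eq_zero_iff_of_isConj`;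
* §3 THE HEADS on `G` (binder prefix = skeleton :97–:99): **(S1) `isClosed_setOf_sub_one_pow_eq_zero`** (`{n(γ)^k = 0}` closed), **(S2)
  `exists_isOpen_forall_sameStratum_mem_iff_isConj`** (STRATA-OPEN: `∀ u, n(u)³ = 0 → ∃ V open, ∀ γ, SameStratum u γ → (γ ∈ V ↔ IsConj u γ)`, `SameStratum` inline),
  **(S3) `isLocallyClosed_carrier_conjClassesMk`** (every unipotent class is locally closed) and **`closure_carrier_conjClassesMk_subset`** (the closure stays in the `≤`-stratum).

HONEST LABEL: HC_CM is proved only modulo the 7 printed citations (2 remaining named inputs: hLiu418 = stmt-HodgeConjecture-24832, h413 = stmt-HodgeConjecture-24833) until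
rung 0 closes; this file is in-house point-set topology ∕ linear algebra over a local field (count-neutral; the print row `stub_N6nsShalika` moves only when all four Shalika
organs are ★ and the desk prices the pay-down).

## References
* [Rogawski1990] J. D. Rogawski, *Automorphic Representations of Unitary Groups in Three Variables*, Ann. of Math. Stud. 123 (1990), §3.9 p. 32, Prop. 3.9.1 (unipotent
  classes of `U(3)`: regular class unique; singular classes `[n(t)]`, `t ∈ E⁰∕N E^×`); §8.1 pp. 112–113 (the germ expansion's use of the unipotent classes).
* [BernsteinZelevinsky1976] I. N. Bernstein, A. V. Zelevinsky, *Representations of the group GL(n, F) where F is a non-archimedean local field*, Russian Math. Surveys 31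
  (1976), §1.5 (l-spaces: locally closed subsets, stratifications).
* [Serre1979] J.-P. Serre, *Local Fields*, GTM 67 (1979), Ch. V §3 (norm groups of local quadratic extensions; principal units), Ch. II §4 (Hensel).
* [PlatonovRapinchuk1994] V. Platonov, A. Rapinchuk, *Algebraic Groups and Number Theory* (1994), §3.1 (topology on `G(K_v)`), §5.1.
* [Mok2014] C. P. Mok, *Endoscopic classification of representations of quasi-split unitary groups*, Mem. AMS 235 (2015), §1 Notation p. 5 (`Φ_N`).
-/

set_option autoImplicit false

noncomputable section

open scoped Valued WithZero Matrix MatrixGroups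
open Topology Set NumberField IsDedekindDomain Matrix Polynomial

namespace Literature.NumberTheory.Rogawski1990

open Literature.NumberTheory.Automorphic Literature.NumberTheory.Automorphic.UnitaryGroup Literature.NumberTheory.GaloisRepresentations
open Literature.NumberTheory.Automorphic.HermitianLattice
/-! ## §2 The carrier `G = U(Φ₃)(L⁺_v) = (cmDatum L 3 Φ₃).Local v` at a non-split place: transport along the one-place model `ψ = e` (frame `T = 1`) -/

section CM

variable (L : Type) [Field L] [NumberField L] [IsCMField L] {v : HeightOneSpectrum (𝓞 ↥(maximalRealSubfield L))} (w : UnitaryGroup.PlacesOver L v)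
  (hw : IsCMField.complexConj L • w.1 = w.1)

/-- The frame of `Φ₃` at `w` is trivial: `(Φ₃)_w = J₀ = ᵗσ_w(1)·J₀·1` (★ `placeForm_antidiagOne`, ★ `formCongr_one_eq`). [cite: Mok2014, §1 Notation p. 5] -/
theorem placeForm_antidiagOne_eq_formCongr_one :
    placeForm (Matrix.of fun i j : Fin 3 => if i.val + j.val + 1 = 3 then (1 : L) else 0) w.1 = formCongr (galAdicCompletionMap (L := L) (IsCMField.complexConj L) hw) (1 : GL (Fin 3) (w.1.adicCompletion L)) ((StdForm.antidiagonal 3).over (w.1.adicCompletion L)) := by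
  rw [formCongr_one_eq, placeForm_antidiagOne]

/-- `ψ = e` (`T = 1`) is continuous into `GL₃(L_w)`. [cite: PlatonovRapinchuk1994, §5.1] -/
theorem continuous_conj_localNonsplitEquiv_one :
    Continuous fun y : (cmDatum L 3 (Matrix.of fun i j : Fin 3 => if i.val + j.val + 1 = 3 then (1 : L) else 0)).Local v => ((1 : GL (Fin 3) (w.1.adicCompletion L)) * ((localNonsplitEquiv (IsCMField.complexConj L) (Matrix.of fun i j : Fin 3 => if i.val + j.val + 1 = 3 then (1 : L) else 0) (IsCMField.complexConj_ne_one L) w hw y : ↥(unitaryGroupOfForm (galAdicCompletionMap (L := L) (IsCMField.complexConj L) hw) (placeForm (Matrix.of fun i j : Fin 3 => if i.val + j.val + 1 = 3 then (1 : L) else 0) w.1))) : GL (Fin 3) (w.1.adicCompletion L)) * (1 : GL (Fin 3) (w.1.adicCompletion L))⁻¹) := by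
  obtain ⟨E, hE⟩ := exists_continuousMulEquiv_coe_eq_localNonsplitEquiv L (Matrix.of fun i j : Fin 3 => if i.val + j.val + 1 = 3 then (1 : L) else 0) v w hw
  have h : Continuous fun y : (cmDatum L 3 (Matrix.of fun i j : Fin 3 => if i.val + j.val + 1 = 3 then (1 : L) else 0)).Local v => (1 : GL (Fin 3) (w.1.adicCompletion L)) * ((E y : ↥(unitaryGroupOfForm (galAdicCompletionMap (L := L) (IsCMField.complexConj L) hw) (placeForm (Matrix.of fun i j : Fin 3 => if i.val + j.val + 1 = 3 then (1 : L) else 0) w.1))) : GL (Fin 3) (w.1.adicCompletion L)) * (1 : GL (Fin 3) (w.1.adicCompletion L))⁻¹ :=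
    (continuous_const.mul (continuous_subtype_val.comp E.continuous)).mul continuous_const
  simp only [hE] at h
  exact h

/-- **Unipotency through `ψ`, both ways** (one place above `v`): `(y − 1)^n = 0` in `GL₃(L ⊗ L⁺_v)` iff `(ψ(y) − 1)^n = 0` in `GL₃(L_w)`. [cite: Rogawski1990, §3.9 p. 32] -/
theorem sub_one_pow_eq_zero_iff_conj_localNonsplitEquiv (hsub : Subsingleton (UnitaryGroup.PlacesOver L v)) (y : (cmDatum L 3 (Matrix.of fun i j : Fin 3 => if i.val + j.val + 1 = 3 then (1 : L) else 0)).Local v) (n : ℕ) :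
    ((y.val : GL (Fin 3) (UnitaryGroup.LocalRing L v)).val - 1) ^ n = 0 ↔ (((((1 : GL (Fin 3) (w.1.adicCompletion L)) * ((localNonsplitEquiv (IsCMField.complexConj L) (Matrix.of fun i j : Fin 3 => if i.val + j.val + 1 = 3 then (1 : L) else 0) (IsCMField.complexConj_ne_one L) w hw y : ↥(unitaryGroupOfForm (galAdicCompletionMap (L := L) (IsCMField.complexConj L) hw) (placeForm (Matrix.of fun i j : Fin 3 => if i.val + j.val + 1 = 3 then (1 : L) else 0) w.1))) : GL (Fin 3) (w.1.adicCompletion L)) * (1 : GL (Fin 3) (w.1.adicCompletion L))⁻¹) : GL (Fin 3) (w.1.adicCompletion L)) : Matrix (Fin 3) (Fin 3) (w.1.adicCompletion L)) - 1) ^ n = 0 := by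
  refine ⟨fun h => conj_localNonsplitEquiv_sub_one_pow_eq_zero L (Matrix.of fun i j : Fin 3 => if i.val + j.val + 1 = 3 then (1 : L) else 0) v w hw h, fun h => ?_⟩
  rw [one_mul, inv_one, mul_one, coe_coe_localNonsplitEquiv_apply] at h
  have h' : ((Pi.evalRingHom (fun w' : UnitaryGroup.PlacesOver L v => w'.1.adicCompletion L) w).mapMatrix (((y.val : GL (Fin 3) (UnitaryGroup.LocalRing L v)).val - 1) ^ n)) = 0 := by
    rw [map_pow, map_sub, map_one, RingHom.mapMatrix_apply]; exact h
  refine Matrix.ext fun i j => funext fun w' => ?_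
  obtain rfl : w = w' := Subsingleton.elim w w'
  have hij := congrFun (congrFun h' i) j
  rw [RingHom.mapMatrix_apply, Matrix.map_apply] at hij
  exact hij

/-- `ψ(y) = 1 ↔ y = 1`. [cite: PlatonovRapinchuk1994, §5.1] -/
theorem conj_localNonsplitEquiv_eq_one_iff (y : (cmDatum L 3 (Matrix.of fun i j : Fin 3 => if i.val + j.val + 1 = 3 then (1 : L) else 0)).Local v) : ((1 : GL (Fin 3) (w.1.adicCompletion L)) * ((localNonsplitEquiv (IsCMField.complexConj L) (Matrix.of fun i j : Fin 3 => if i.val + j.val + 1 = 3 then (1 : L) else 0) (IsCMField.complexConj_ne_one L) w hw y : ↥(unitaryGroupOfForm (galAdicCompletionMap (L := L) (IsCMField.complexConj L) hw) (placeForm (Matrix.of fun i j : Fin 3 => if i.val + j.val + 1 = 3 then (1 : L) else 0) w.1))) : GL (Fin 3) (w.1.adicCompletion L)) * (1 : GL (Fin 3) (w.1.adicCompletion L))⁻¹) = 1 ↔ y = 1 := by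
  constructor
  · intro h
    refine conj_localNonsplitEquiv_injective L (Matrix.of fun i j : Fin 3 => if i.val + j.val + 1 = 3 then (1 : L) else 0) v w hw (T := 1) ?_
    rw [h, conj_localNonsplitEquiv_one]
  · rintro rfl; exact conj_localNonsplitEquiv_one L (Matrix.of fun i j : Fin 3 => if i.val + j.val + 1 = 3 then (1 : L) else 0) v w hw

/-- **`IsConj` through `ψ`**: `u ~ γ` in `G` iff `k·ψ(u)·k⁻¹ = ψ(γ)` for some `k ∈ U(σ_w, J₀)(L_w)` (★ `conjClasses_mk_eq_iff_exists_conj` at `T = 1`). [cite: Rogawski1990, §3.9 p. 32] -/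
theorem isConj_iff_exists_conj_localNonsplitEquiv (u γ : (cmDatum L 3 (Matrix.of fun i j : Fin 3 => if i.val + j.val + 1 = 3 then (1 : L) else 0)).Local v) :
    IsConj u γ ↔ ∃ k : GL (Fin 3) (w.1.adicCompletion L), k ∈ unitaryGroupOfForm (galAdicCompletionMap (L := L) (IsCMField.complexConj L) hw) ((StdForm.antidiagonal 3).over (w.1.adicCompletion L)) ∧ k * ((1 : GL (Fin 3) (w.1.adicCompletion L)) * ((localNonsplitEquiv (IsCMField.complexConj L) (Matrix.of fun i j : Fin 3 => if i.val + j.val + 1 = 3 then (1 : L) else 0) (IsCMField.complexConj_ne_one L) w hw u : ↥(unitaryGroupOfForm (galAdicCompletionMap (L := L) (IsCMField.complexConj L) hw) (placeForm (Matrix.of fun i j : Fin 3 => if i.val + j.val + 1 = 3 then (1 : L) else 0) w.1))) : GL (Fin 3) (w.1.adicCompletion L)) * (1 : GL (Fin 3) (w.1.adicCompletion L))⁻¹) * k⁻¹ = ((1 : GL (Fin 3) (w.1.adicCompletion L)) * ((localNonsplitEquiv (IsCMField.complexConj L) (Matrix.of fun i j : Fin 3 => if i.val + j.val + 1 = 3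 then (1 : L) else 0) (IsCMField.complexConj_ne_one L) w hw γ : ↥(unitaryGroupOfForm (galAdicCompletionMap (L := L) (IsCMField.complexConj L) hw) (placeForm (Matrix.of fun i j : Fin 3 => if i.val + j.val + 1 = 3 then (1 : L) else 0) w.1))) : GL (Fin 3) (w.1.adicCompletion L)) * (1 : GL (Fin 3) (w.1.adicCompletion L))⁻¹) := by
  rw [← ConjClasses.mk_eq_mk_iff_isConj]
  exact conjClasses_mk_eq_iff_exists_conj L (Matrix.of fun i j : Fin 3 => if i.val + j.val + 1 = 3 then (1 : L) else 0) v w hw (placeForm_antidiagOne_eq_formCongr_one L w hw) u γ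

include w hw in
/-- Conjugation inside `G` preserves each condition `(γ − 1)^n = 0`. [cite: Rogawski1990, §3.9 p. 32] -/
theorem sub_one_pow_eq_zero_iff_of_isConj (hsub : Subsingleton (UnitaryGroup.PlacesOver L v)) {u γ : (cmDatum L 3 (Matrix.of fun i j : Fin 3 => if i.val + j.val + 1 = 3 then (1 : L) else 0)).Local v} (h : IsConj u γ) (n : ℕ) :
    ((u.val : GL (Fin 3) (UnitaryGroup.LocalRing L v)).val - 1) ^ n = 0 ↔ ((γ.val : GL (Fin 3) (UnitaryGroup.LocalRing L v)).val - 1) ^ n = 0 := by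
  obtain ⟨k, -, hk⟩ := (isConj_iff_exists_conj_localNonsplitEquiv L w hw u γ).1 h
  rw [sub_one_pow_eq_zero_iff_conj_localNonsplitEquiv L w hw hsub u n, sub_one_pow_eq_zero_iff_conj_localNonsplitEquiv L w hw hsub γ n, ← hk,
    coe_conj_sub_one k, Units.conj_pow k, coe_mul_mul_coe_inv_eq_zero_iff k]

end CM

/-! ## §3 The three heads on `G = U(Φ₃)(L⁺_v)` at an ODD non-split place (skeleton a42538b5 :97–:99 setting) -/

section Heads

/-- **(S1) CLOSED STRATA**: for every `k`, `{γ ∈ U(Φ₃)(L⁺_v) | (γ − 1)^k = 0}` is closed (the matrix coefficients are continuous on the local carrier).  (The place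
hypotheses are carried for the organ's uniform binder prefix; only continuity is used.) [cite: Rogawski1990, §3.9 p. 32] [cite: BernsteinZelevinsky1976, §1.5] -/
theorem isClosed_setOf_sub_one_pow_eq_zero :
    ∀ (L : Type) [Field L] [NumberField L] [IsCMField L] (v : HeightOneSpectrum (𝓞 ↥(maximalRealSubfield L))) (w : UnitaryGroup.PlacesOver L v),
      Subsingleton (UnitaryGroup.PlacesOver L v) → IsUnit (2 : 𝒪[w.1.adicCompletion L]) →
      ∀ k : ℕ, IsClosed {γ : (cmDatum L 3 (Matrix.of fun i j : Fin 3 => if i.val + j.val + 1 = 3 then (1 : L) else 0)).Local v | ((γ.val : GL (Fin 3) (UnitaryGroup.LocalRing L v)).val - 1) ^ k = 0} := by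
  intro L _ _ _ v w hsub _ k
  have hw : IsCMField.complexConj L • w.1 = w.1 := smul_placesOver_eq_of_subsingleton L v (IsCMField.complexConj L) hsub w
  have hset : {γ : (cmDatum L 3 (Matrix.of fun i j : Fin 3 => if i.val + j.val + 1 = 3 then (1 : L) else 0)).Local v | ((γ.val : GL (Fin 3) (UnitaryGroup.LocalRing L v)).val - 1) ^ k = 0} =
      (fun y : (cmDatum L 3 (Matrix.of fun i j : Fin 3 => if i.val + j.val + 1 = 3 then (1 : L) else 0)).Local v => ((1 : GL (Fin 3) (w.1.adicCompletion L)) * ((localNonsplitEquiv (IsCMField.complexConj L) (Matrix.of fun i j : Fin 3 => if i.val + j.val + 1 = 3 then (1 : L) else 0) (IsCMField.complexConj_ne_one L) w hw y : ↥(unitaryGroupOfForm (galAdicCompletionMap (L := L) (IsCMField.complexConj L) hw) (placeForm (Matrix.of fun i j : Fin 3 => if i.val + j.val + 1 = 3 then (1 : L) else 0) w.1))) : GL (Fin 3) (w.1.adicCompletion L)) * (1 : GL (Fin 3) (w.1.adicCompletion L))⁻¹)) ⁻¹' {g : GL (Fin 3) (w.1.adicCompletion L) | ((g : Matrix (Fin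 3) (Fin 3) (w.1.adicCompletion L)) - 1) ^ k = 0} := by
    ext γ
    exact sub_one_pow_eq_zero_iff_conj_localNonsplitEquiv L w hw hsub γ k
  rw [hset]
  exact (isClosed_setOf_coe_sub_one_pow_eq_zero k).preimage (continuous_conj_localNonsplitEquiv_one L w hw)

/-- **(S2) STRATA-OPEN — EVERY UNIPOTENT CLASS OF `U(Φ₃)(L⁺_v)` IS CUT OUT BY AN OPEN SET INSIDE ITS STRATUM** (odd non-split place).  With
`SameStratum u γ :≡ (γ−1)³ = 0 ∧ ((γ−1)² = 0 ↔ (u−1)² = 0) ∧ (γ = 1 ↔ u = 1)` (spelled inline): for every unipotent `u` there is an OPEN `V ⊆ G` with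
`γ ∈ V ↔ IsConj u γ` for all `γ` in the stratum of `u`.  By [Rogawski1990, §3.9 Prop. 3.9.1]: order `3` — `V = univ`, the regular unipotent class is UNIQUE when `2 ∈ 𝒪_w^×`
(★ `exists_conj_eq_of_regular_unipotent`); order `2` — the transvection classes `[n(t)]` are told apart by the norm class of the invariant `B₀(x, (γ−1)x) ∈ t·N(L_w)` (★
`range_B₀_conj_sub_one_mulVec`, ★ `exists_conj_eq_iff_exists_norm_mul`), which is LOCALLY CONSTANT because a `σ_w`-fixed principal unit is a norm at odd residue characteristic
(§1, Hensel); order `1` — `V = univ`.  Transport to the one-place model by ★ `localNonsplitEquiv` (`UnipotentLevelPiecesFrameCM`, frame `T = 1`).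
[cite: Rogawski1990, §3.9 p. 32, Prop. 3.9.1] [cite: BernsteinZelevinsky1976, §1.5] -/
theorem exists_isOpen_forall_sameStratum_mem_iff_isConj :
    ∀ (L : Type) [Field L] [NumberField L] [IsCMField L] (v : HeightOneSpectrum (𝓞 ↥(maximalRealSubfield L))) (w : UnitaryGroup.PlacesOver L v),
      Subsingleton (UnitaryGroup.PlacesOver L v) → IsUnit (2 : 𝒪[w.1.adicCompletion L]) →
      ∀ u : (cmDatum L 3 (Matrix.of fun i j : Fin 3 => if i.val + j.val + 1 = 3 then (1 : L) else 0)).Local v, ((u.val : GL (Fin 3) (UnitaryGroup.LocalRing L v)).val - 1) ^ 3 = 0 →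
        ∃ V : Set ((cmDatum L 3 (Matrix.of fun i j : Fin 3 => if i.val + j.val + 1 = 3 then (1 : L) else 0)).Local v), IsOpen V ∧
          ∀ γ : (cmDatum L 3 (Matrix.of fun i j : Fin 3 => if i.val + j.val + 1 = 3 then (1 : L) else 0)).Local v, (((γ.val : GL (Fin 3) (UnitaryGroup.LocalRing L v)).val - 1) ^ 3 = 0 ∧ (((γ.val : GL (Fin 3) (UnitaryGroup.LocalRing L v)).val - 1) ^ 2 = 0 ↔ ((u.val : GL (Fin 3) (UnitaryGroup.LocalRing L v)).val - 1) ^ 2 = 0) ∧ (γ = 1 ↔ u = 1)) →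
            (γ ∈ V ↔ IsConj u γ) := by
  intro L _ _ _ v w hsub h2 u hu3
  have hw : IsCMField.complexConj L • w.1 = w.1 := smul_placesOver_eq_of_subsingleton L v (IsCMField.complexConj L) hsub w
  haveI : HenselianLocalRing 𝒪[w.1.adicCompletion L] := inferInstanceAs (HenselianLocalRing (w.1.adicCompletionIntegers L))
  have hint : (Valued.v (R := (w.1.adicCompletion L))).Integers 𝒪[(w.1.adicCompletion L)] := Valuation.integer.integers _
  have h2v : Valued.v (2 : (w.1.adicCompletion L)) = 1 := by
    have h := hint.isUnit_iff_valuation_eq_one.mp h2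
    rwa [map_ofNat] at h
  have h2K : (2 : (w.1.adicCompletion L)) ≠ 0 := fun h0 => by rw [h0, map_zero] at h2v; exact zero_ne_one h2v
  have hσ : ∀ z : (w.1.adicCompletion L), (galAdicCompletionMap (L := L) (IsCMField.complexConj L) hw) ((galAdicCompletionMap (L := L) (IsCMField.complexConj L) hw) z) = z := galAdicCompletionMap_involutive L v w hw
  have hvσ : ∀ a : (w.1.adicCompletion L), Valued.v ((galAdicCompletionMap (L := L) (IsCMField.complexConj L) hw) a) = Valued.v a := fun a => by
    simp only [valued_galAdicCompletionMap]
  have hT := placeForm_antidiagOne_eq_formCongr_one L w hw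
  -- `ψ(y) ∈ U(σ_w, J₀)`
  have hmem : ∀ y : (cmDatum L 3 (Matrix.of fun i j : Fin 3 => if i.val + j.val + 1 = 3 then (1 : L) else 0)).Local v, ((1 : GL (Fin 3) (w.1.adicCompletion L)) * ((localNonsplitEquiv (IsCMField.complexConj L) (Matrix.of fun i j : Fin 3 => if i.val + j.val + 1 = 3 then (1 : L) else 0) (IsCMField.complexConj_ne_one L) w hw y : ↥(unitaryGroupOfForm (galAdicCompletionMap (L := L) (IsCMField.complexConj L) hw) (placeForm (Matrix.of fun i j : Fin 3 => if i.val + j.val + 1 = 3 then (1 : L) else 0) w.1))) : GL (Fin 3) (w.1.adicCompletion L)) * (1 : GL (Fin 3) (w.1.adicCompletion L))⁻¹) ∈ unitaryGroupOfForm (galAdicCompletionMap (L := L) (IsCMField.complexConj L) hw) ((StdForm.antidiagonal 3).over (w.1.adicCompletion L)) := fun y => conj_localNonsplitEquiv_mem L (Matrix.of fun i j : Fin 3 => if i.val + j.val + 1 = 3 then (1 : L) else 0) v w hw hT y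
  by_cases hu1 : u = 1
  · -- order 1: the stratum of `1` is `{1}`
    refine ⟨Set.univ, isOpen_univ, fun γ hγ => ⟨fun _ => ?_, fun _ => Set.mem_univ _⟩⟩
    rw [hu1, hγ.2.2.2 hu1]
  by_cases hu2 : ((u.val : GL (Fin 3) (UnitaryGroup.LocalRing L v)).val - 1) ^ 2 = 0
  · -- order 2: transvections
    have hψ2 : ((((((1 : GL (Fin 3) (w.1.adicCompletion L)) * ((localNonsplitEquiv (IsCMField.complexConj L) (Matrix.of fun i j : Fin 3 => if i.val + j.val + 1 = 3 then (1 : L) else 0) (IsCMField.complexConj_ne_one L) w hw u : ↥(unitaryGroupOfForm (galAdicCompletionMap (L := L) (IsCMField.complexConj L) hw) (placeForm (Matrix.of fun i j : Fin 3 => if i.val + j.val + 1 = 3 then (1 : L) else 0) w.1))) : GL (Fin 3) (w.1.adicCompletion L)) * (1 : GL (Fin 3) (w.1.adicCompletion L))⁻¹) : GL (Fin 3) (w.1.adicCompletion L)) : Matrix (Fin 3) (Fin 3) (w.1.adicCompletion L)) - 1)) * ((((((1 : GL (Fin 3) (w.1.adicCompletion L)) * ((localNonsplitEquiv (IsCMField.complexConj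 L) (Matrix.of fun i j : Fin 3 => if i.val + j.val + 1 = 3 then (1 : L) else 0) (IsCMField.complexConj_ne_one L) w hw u : ↥(unitaryGroupOfForm (galAdicCompletionMap (L := L) (IsCMField.complexConj L) hw) (placeForm (Matrix.of fun i j : Fin 3 => if i.val + j.val + 1 = 3 then (1 : L) else 0) w.1))) : GL (Fin 3) (w.1.adicCompletion L)) * (1 : GL (Fin 3) (w.1.adicCompletion L))⁻¹) : GL (Fin 3) (w.1.adicCompletion L)) : Matrix (Fin 3) (Fin 3) (w.1.adicCompletion L)) - 1)) = 0 := by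
      rw [← pow_two]; exact (sub_one_pow_eq_zero_iff_conj_localNonsplitEquiv L w hw hsub u 2).1 hu2
    have hψ1 : ((1 : GL (Fin 3) (w.1.adicCompletion L)) * ((localNonsplitEquiv (IsCMField.complexConj L) (Matrix.of fun i j : Fin 3 => if i.val + j.val + 1 = 3 then (1 : L) else 0) (IsCMField.complexConj_ne_one L) w hw u : ↥(unitaryGroupOfForm (galAdicCompletionMap (L := L) (IsCMField.complexConj L) hw) (placeForm (Matrix.of fun i j : Fin 3 => if i.val + j.val + 1 = 3 then (1 : L) else 0) w.1))) : GL (Fin 3) (w.1.adicCompletion L)) * (1 : GL (Fin 3) (w.1.adicCompletion L))⁻¹) ≠ 1 := fun h => hu1 ((conj_localNonsplitEquiv_eq_one_iff L w hw u).1 h)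
    obtain ⟨V₀, hV₀, hcls, hconv⟩ := exists_isOpen_transvection_class (galAdicCompletionMap (L := L) (IsCMField.complexConj L) hw) hσ hvσ h2v (hmem u) hψ2 hψ1
    refine ⟨(fun y : (cmDatum L 3 (Matrix.of fun i j : Fin 3 => if i.val + j.val + 1 = 3 then (1 : L) else 0)).Local v => ((1 : GL (Fin 3) (w.1.adicCompletion L)) * ((localNonsplitEquiv (IsCMField.complexConj L) (Matrix.of fun i j : Fin 3 => if i.val + j.val + 1 = 3 then (1 : L) else 0) (IsCMField.complexConj_ne_one L) w hw y : ↥(unitaryGroupOfForm (galAdicCompletionMap (L := L) (IsCMField.complexConj L) hw) (placeForm (Matrix.of fun i j : Fin 3 => if i.val + j.val + 1 = 3 then (1 : L) else 0) w.1))) : GL (Fin 3) (w.1.adicCompletion L)) * (1 : GL (Fin 3) (w.1.adicCompletion L))⁻¹)) ⁻¹' V₀, hV₀.preimage (continuous_conj_localNonsplitEquiv_one L w hw), fun γ hγ => ?_⟩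
    obtain ⟨hγ3, hγ2, hγ1⟩ := hγ
    have hγ2' : ((γ.val : GL (Fin 3) (UnitaryGroup.LocalRing L v)).val - 1) ^ 2 = 0 := hγ2.2 hu2
    have hγne : γ ≠ 1 := fun h => hu1 (hγ1.1 h)
    constructor
    · intro hV
      have hψγ2 : ((((((1 : GL (Fin 3) (w.1.adicCompletion L)) * ((localNonsplitEquiv (IsCMField.complexConj L) (Matrix.of fun i j : Fin 3 => if i.val + j.val + 1 = 3 then (1 : L) else 0) (IsCMField.complexConj_ne_one L) w hw γ : ↥(unitaryGroupOfForm (galAdicCompletionMap (L := L) (IsCMField.complexConj L) hw) (placeForm (Matrix.of fun i j : Fin 3 => if i.val + j.val + 1 = 3 then (1 : L) else 0) w.1))) : GL (Fin 3) (w.1.adicCompletion L)) * (1 : GL (Fin 3) (w.1.adicCompletion L))⁻¹) : GL (Fin 3) (w.1.adicCompletion L)) : Matrix (Fin 3) (Fin 3) (w.1.adicCompletion L)) - 1)) * ((((((1 : GL (Fin 3) (w.1.adicCompletion L)) * ((localNonsplitEquiv (IsCMField.complexConj L) (Matrix.of fun i j : Fin 3 => if i.val + j.val + 1 = 3 then (1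 : L) else 0) (IsCMField.complexConj_ne_one L) w hw γ : ↥(unitaryGroupOfForm (galAdicCompletionMap (L := L) (IsCMField.complexConj L) hw) (placeForm (Matrix.of fun i j : Fin 3 => if i.val + j.val + 1 = 3 then (1 : L) else 0) w.1))) : GL (Fin 3) (w.1.adicCompletion L)) * (1 : GL (Fin 3) (w.1.adicCompletion L))⁻¹) : GL (Fin 3) (w.1.adicCompletion L)) : Matrix (Fin 3) (Fin 3) (w.1.adicCompletion L)) - 1)) = 0 := by
        rw [← pow_two]; exact (sub_one_pow_eq_zero_iff_conj_localNonsplitEquiv L w hw hsub γ 2).1 hγ2'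
      have hψγ1 : ((1 : GL (Fin 3) (w.1.adicCompletion L)) * ((localNonsplitEquiv (IsCMField.complexConj L) (Matrix.of fun i j : Fin 3 => if i.val + j.val + 1 = 3 then (1 : L) else 0) (IsCMField.complexConj_ne_one L) w hw γ : ↥(unitaryGroupOfForm (galAdicCompletionMap (L := L) (IsCMField.complexConj L) hw) (placeForm (Matrix.of fun i j : Fin 3 => if i.val + j.val + 1 = 3 then (1 : L) else 0) w.1))) : GL (Fin 3) (w.1.adicCompletion L)) * (1 : GL (Fin 3) (w.1.adicCompletion L))⁻¹) ≠ 1 := fun h => hγne ((conj_localNonsplitEquiv_eq_one_iff L w hw γ).1 h)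
      obtain ⟨k, hk, hkc⟩ := hconv _ (hmem γ) hψγ2 hψγ1 hV
      exact (isConj_iff_exists_conj_localNonsplitEquiv L w hw u γ).2 ⟨k, hk, hkc⟩
    · intro hc
      obtain ⟨k, hk, hkc⟩ := (isConj_iff_exists_conj_localNonsplitEquiv L w hw u γ).1 hc
      show ((1 : GL (Fin 3) (w.1.adicCompletion L)) * ((localNonsplitEquiv (IsCMField.complexConj L) (Matrix.of fun i j : Fin 3 => if i.val + j.val + 1 = 3 then (1 : L) else 0) (IsCMField.complexConj_ne_one L) w hw γ : ↥(unitaryGroupOfForm (galAdicCompletionMap (L := L) (IsCMField.complexConj L) hw) (placeForm (Matrix.of fun i j : Fin 3 => if i.val + j.val + 1 = 3 then (1 : L) else 0) w.1))) : GL (Fin 3) (w.1.adicCompletion L)) * (1 : GL (Fin 3) (w.1.adicCompletion L))⁻¹) ∈ V₀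
      rw [← hkc]
      exact hcls k hk
  · -- order 3: regular unipotents form ONE class
    refine ⟨Set.univ, isOpen_univ, fun γ hγ => ⟨fun _ => ?_, fun _ => Set.mem_univ _⟩⟩
    obtain ⟨hγ3, hγ2, -⟩ := hγ
    have hγ2' : ¬ ((γ.val : GL (Fin 3) (UnitaryGroup.LocalRing L v)).val - 1) ^ 2 = 0 := fun h => hu2 (hγ2.1 h)
    have hnil : ∀ y : (cmDatum L 3 (Matrix.of fun i j : Fin 3 => if i.val + j.val + 1 = 3 then (1 : L) else 0)).Local v, ((y.val : GL (Fin 3) (UnitaryGroup.LocalRing L v)).val - 1) ^ 3 = 0 → IsNilpotent (((((1 : GL (Fin 3) (w.1.adicCompletion L)) * ((localNonsplitEquiv (IsCMField.complexConj L) (Matrix.of fun i j : Fin 3 => if i.val + j.val + 1 = 3 then (1 : L) else 0) (IsCMField.complexConj_ne_one L) w hw y : ↥(unitaryGroupOfForm (galAdicCompletionMap (L := L) (IsCMField.complexConj L) hw) (placeForm (Matrix.of fun i j : Fin 3 => if i.val + j.val + 1 = 3 then (1 : L) else 0) w.1))) : GL (Fin 3) (w.1.adicCompletion L)) * (1 :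 GL (Fin 3) (w.1.adicCompletion L))⁻¹) : GL (Fin 3) (w.1.adicCompletion L)) : Matrix (Fin 3) (Fin 3) (w.1.adicCompletion L)) - 1) :=
      fun y hy => ⟨3, (sub_one_pow_eq_zero_iff_conj_localNonsplitEquiv L w hw hsub y 3).1 hy⟩
    have hreg : ∀ y : (cmDatum L 3 (Matrix.of fun i j : Fin 3 => if i.val + j.val + 1 = 3 then (1 : L) else 0)).Local v, ¬ ((y.val : GL (Fin 3) (UnitaryGroup.LocalRing L v)).val - 1) ^ 2 = 0 →
        ((((((1 : GL (Fin 3) (w.1.adicCompletion L)) * ((localNonsplitEquiv (IsCMField.complexConj L) (Matrix.of fun i j : Fin 3 => if i.val + j.val + 1 = 3 then (1 : L) else 0) (IsCMField.complexConj_ne_one L) w hw y : ↥(unitaryGroupOfForm (galAdicCompletionMap (L := L) (IsCMField.complexConj L) hw) (placeForm (Matrix.of fun i j : Fin 3 => if i.val + j.val + 1 = 3 then (1 : L) else 0) w.1))) : GL (Fin 3) (w.1.adicCompletion L)) * (1 : GL (Fin 3) (w.1.adicCompletion L))⁻¹) : GL (Fin 3) (w.1.adicCompletion L)) : Matrix (Fin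 3) (Fin 3) (w.1.adicCompletion L)) - 1)) * ((((((1 : GL (Fin 3) (w.1.adicCompletion L)) * ((localNonsplitEquiv (IsCMField.complexConj L) (Matrix.of fun i j : Fin 3 => if i.val + j.val + 1 = 3 then (1 : L) else 0) (IsCMField.complexConj_ne_one L) w hw y : ↥(unitaryGroupOfForm (galAdicCompletionMap (L := L) (IsCMField.complexConj L) hw) (placeForm (Matrix.of fun i j : Fin 3 => if i.val + j.val + 1 = 3 then (1 : L) else 0) w.1))) : GL (Fin 3) (w.1.adicCompletion L)) * (1 : GL (Fin 3) (w.1.adicCompletion L))⁻¹) : GL (Fin 3) (w.1.adicCompletion L)) : Matrix (Fin 3) (Fin 3) (w.1.adicCompletion L)) - 1)) ≠ 0 :=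
      fun y hy h => hy ((sub_one_pow_eq_zero_iff_conj_localNonsplitEquiv L w hw hsub y 2).2 (by rw [pow_two]; exact h))
    obtain ⟨k, hk, hkc⟩ := exists_conj_eq_of_regular_unipotent (galAdicCompletionMap (L := L) (IsCMField.complexConj L) hw) hσ h2K (hmem u) (hmem γ) (hnil u hu3) (hnil γ hγ3) (hreg u hu2) (hreg γ hγ2')
    exact (isConj_iff_exists_conj_localNonsplitEquiv L w hw u γ).2 ⟨k, hk, hkc⟩

/-- **(S3a) EVERY UNIPOTENT CLASS IS LOCALLY CLOSED** in `U(Φ₃)(L⁺_v)` (odd non-split place): `C(u) = V ∩ {(γ−1)³ = 0} ∩ {(γ−1)² = 0 ↔ (u−1)² = 0} ∩ {γ = 1 ↔ u = 1}`,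
open ∩ (closed or open) pieces — the hypothesis `IsLocallyClosed 𝒪(u)` of the locally-closed-orbit embedding (SPAN-b) for the four unipotent classes.
[cite: Rogawski1990, §3.9 p. 32, Prop. 3.9.1] [cite: BernsteinZelevinsky1976, §1.5] -/
theorem isLocallyClosed_carrier_conjClassesMk :
    ∀ (L : Type) [Field L] [NumberField L] [IsCMField L] (v : HeightOneSpectrum (𝓞 ↥(maximalRealSubfield L))) (w : UnitaryGroup.PlacesOver L v),
      Subsingleton (UnitaryGroup.PlacesOver L v) → IsUnit (2 : 𝒪[w.1.adicCompletion L]) →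
      ∀ u : (cmDatum L 3 (Matrix.of fun i j : Fin 3 => if i.val + j.val + 1 = 3 then (1 : L) else 0)).Local v, ((u.val : GL (Fin 3) (UnitaryGroup.LocalRing L v)).val - 1) ^ 3 = 0 → IsLocallyClosed (ConjClasses.mk u).carrier := by
  intro L _ _ _ v w hsub h2 u hu3
  have hw : IsCMField.complexConj L • w.1 = w.1 := smul_placesOver_eq_of_subsingleton L v (IsCMField.complexConj L) hsub w
  obtain ⟨V, hV, hVu⟩ := exists_isOpen_forall_sameStratum_mem_iff_isConj L v w hsub h2 u hu3
  have hS3 : IsClosed {γ : (cmDatum L 3 (Matrix.of fun i j : Fin 3 => if i.val + j.val + 1 = 3 then (1 : L) else 0)).Local v | ((γ.val : GL (Fin 3) (UnitaryGroup.LocalRing L v)).val - 1) ^ 3 = 0} := isClosed_setOf_sub_one_pow_eq_zero L v w hsub h2 3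
  have hS2 : IsLocallyClosed {γ : (cmDatum L 3 (Matrix.of fun i j : Fin 3 => if i.val + j.val + 1 = 3 then (1 : L) else 0)).Local v | ((γ.val : GL (Fin 3) (UnitaryGroup.LocalRing L v)).val - 1) ^ 2 = 0 ↔ ((u.val : GL (Fin 3) (UnitaryGroup.LocalRing L v)).val - 1) ^ 2 = 0} := by
    by_cases hu2 : ((u.val : GL (Fin 3) (UnitaryGroup.LocalRing L v)).val - 1) ^ 2 = 0
    · have : {γ : (cmDatum L 3 (Matrix.of fun i j : Fin 3 => if i.val + j.val + 1 = 3 then (1 : L) else 0)).Local v | ((γ.val : GL (Fin 3) (UnitaryGroup.LocalRing L v)).val - 1) ^ 2 = 0 ↔ ((u.val : GL (Fin 3) (UnitaryGroup.LocalRing L v)).val - 1) ^ 2 = 0} = {γ : (cmDatum L 3 (Matrix.of fun i j : Fin 3 => if i.val + j.val + 1 = 3 then (1 : L) else 0)).Local v | ((γ.val : GL (Fin 3) (UnitaryGroup.LocalRing L v)).val - 1) ^ 2 = 0} := by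
        ext γ; simp only [Set.mem_setOf_eq, hu2, iff_true]
      rw [this]; exact (isClosed_setOf_sub_one_pow_eq_zero L v w hsub h2 2).isLocallyClosed
    · have : {γ : (cmDatum L 3 (Matrix.of fun i j : Fin 3 => if i.val + j.val + 1 = 3 then (1 : L) else 0)).Local v | ((γ.val : GL (Fin 3) (UnitaryGroup.LocalRing L v)).val - 1) ^ 2 = 0 ↔ ((u.val : GL (Fin 3) (UnitaryGroup.LocalRing L v)).val - 1) ^ 2 = 0} = {γ : (cmDatum L 3 (Matrix.of fun i j : Fin 3 => if i.val + j.val + 1 = 3 then (1 : L) else 0)).Local v | ((γ.val : GL (Fin 3) (UnitaryGroup.LocalRing L v)).val - 1) ^ 2 = 0}ᶜ := by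
        ext γ; simp only [Set.mem_setOf_eq, hu2, iff_false, Set.mem_compl_iff]
      rw [this]; exact (isClosed_setOf_sub_one_pow_eq_zero L v w hsub h2 2).isOpen_compl.isLocallyClosed
  have hS1 : IsLocallyClosed {γ : (cmDatum L 3 (Matrix.of fun i j : Fin 3 => if i.val + j.val + 1 = 3 then (1 : L) else 0)).Local v | γ = 1 ↔ u = 1} := by
    have h1 : IsClosed {γ : (cmDatum L 3 (Matrix.of fun i j : Fin 3 => if i.val + j.val + 1 = 3 then (1 : L) else 0)).Local v | γ = 1} := isClosed_eq continuous_id continuous_const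
    by_cases hu1 : u = 1
    · have : {γ : (cmDatum L 3 (Matrix.of fun i j : Fin 3 => if i.val + j.val + 1 = 3 then (1 : L) else 0)).Local v | γ = 1 ↔ u = 1} = {γ : (cmDatum L 3 (Matrix.of fun i j : Fin 3 => if i.val + j.val + 1 = 3 then (1 : L) else 0)).Local v | γ = 1} := by ext γ; simp only [Set.mem_setOf_eq, hu1, iff_true]
      rw [this]; exact h1.isLocallyClosed
    · have : {γ : (cmDatum L 3 (Matrix.of fun i j : Fin 3 => if i.val + j.val + 1 = 3 then (1 : L) else 0)).Local v | γ = 1 ↔ u = 1} = {γ : (cmDatum L 3 (Matrix.of fun i j : Fin 3 => if i.val + j.val + 1 = 3 then (1 : L) else 0)).Local v | γ = 1}ᶜ := by ext γ; simp only [Set.mem_setOf_eq, hu1, iff_false, Set.mem_compl_iff]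
      rw [this]; exact h1.isOpen_compl.isLocallyClosed
  have hcar : (ConjClasses.mk u).carrier = V ∩ ({γ : (cmDatum L 3 (Matrix.of fun i j : Fin 3 => if i.val + j.val + 1 = 3 then (1 : L) else 0)).Local v | ((γ.val : GL (Fin 3) (UnitaryGroup.LocalRing L v)).val - 1) ^ 3 = 0} ∩ ({γ : (cmDatum L 3 (Matrix.of fun i j : Fin 3 => if i.val + j.val + 1 = 3 then (1 : L) else 0)).Local v | ((γ.val : GL (Fin 3) (UnitaryGroup.LocalRing L v)).val - 1) ^ 2 = 0 ↔ ((u.val : GL (Fin 3) (UnitaryGroup.LocalRing L v)).val - 1) ^ 2 = 0} ∩ {γ : (cmDatum L 3 (Matrix.of fun i j : Fin 3 => if i.val + j.val + 1 = 3 then (1 : L) else 0)).Local v | γ = 1 ↔ u = 1})) := by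
    ext γ
    rw [ConjClasses.mem_carrier_iff_mk_eq, ConjClasses.mk_eq_mk_iff_isConj, isConj_comm]
    simp only [Set.mem_inter_iff, Set.mem_setOf_eq]
    constructor
    · intro hc
      have h3 : ((γ.val : GL (Fin 3) (UnitaryGroup.LocalRing L v)).val - 1) ^ 3 = 0 := (sub_one_pow_eq_zero_iff_of_isConj L w hw hsub hc 3).1 hu3
      have h2' : ((γ.val : GL (Fin 3) (UnitaryGroup.LocalRing L v)).val - 1) ^ 2 = 0 ↔ ((u.val : GL (Fin 3) (UnitaryGroup.LocalRing L v)).val - 1) ^ 2 = 0 := (sub_one_pow_eq_zero_iff_of_isConj L w hw hsub hc 2).symm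
      have h1 : γ = 1 ↔ u = 1 := by
        constructor
        · rintro rfl; exact isConj_one_left.1 hc
        · rintro rfl; exact isConj_one_right.1 hc
      exact ⟨(hVu γ ⟨h3, h2', h1⟩).2 hc, h3, h2', h1⟩
    · rintro ⟨hV', h3, h2', h1⟩
      exact (hVu γ ⟨h3, h2', h1⟩).1 hV'
  rw [hcar]
  exact hV.isLocallyClosed.inter (hS3.isLocallyClosed.inter (hS2.inter hS1))

/-- **(S3b) THE CLOSURE OF A UNIPOTENT CLASS STAYS IN ITS `≤`-STRATUM**: `closure C(u) ⊆ {(γ−1)³ = 0} ∩ {(u−1)² = 0 → (γ−1)² = 0}` (both closed and `C(u)` lies in them).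
[cite: Rogawski1990, §3.9 p. 32] [cite: BernsteinZelevinsky1976, §1.5] -/
theorem closure_carrier_conjClassesMk_subset :
    ∀ (L : Type) [Field L] [NumberField L] [IsCMField L] (v : HeightOneSpectrum (𝓞 ↥(maximalRealSubfield L))) (w : UnitaryGroup.PlacesOver L v),
      Subsingleton (UnitaryGroup.PlacesOver L v) → IsUnit (2 : 𝒪[w.1.adicCompletion L]) →
      ∀ u : (cmDatum L 3 (Matrix.of fun i j : Fin 3 => if i.val + j.val + 1 = 3 then (1 : L) else 0)).Local v, ((u.val : GL (Fin 3) (UnitaryGroup.LocalRing L v)).val - 1) ^ 3 = 0 →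
        closure (ConjClasses.mk u).carrier ⊆ {γ : (cmDatum L 3 (Matrix.of fun i j : Fin 3 => if i.val + j.val + 1 = 3 then (1 : L) else 0)).Local v | ((γ.val : GL (Fin 3) (UnitaryGroup.LocalRing L v)).val - 1) ^ 3 = 0 ∧ (((u.val : GL (Fin 3) (UnitaryGroup.LocalRing L v)).val - 1) ^ 2 = 0 → ((γ.val : GL (Fin 3) (UnitaryGroup.LocalRing L v)).val - 1) ^ 2 = 0)} := by
  intro L _ _ _ v w hsub h2 u hu3
  have hw : IsCMField.complexConj L • w.1 = w.1 := smul_placesOver_eq_of_subsingleton L v (IsCMField.complexConj L) hsub w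
  have hclosed : IsClosed {γ : (cmDatum L 3 (Matrix.of fun i j : Fin 3 => if i.val + j.val + 1 = 3 then (1 : L) else 0)).Local v | ((γ.val : GL (Fin 3) (UnitaryGroup.LocalRing L v)).val - 1) ^ 3 = 0 ∧ (((u.val : GL (Fin 3) (UnitaryGroup.LocalRing L v)).val - 1) ^ 2 = 0 → ((γ.val : GL (Fin 3) (UnitaryGroup.LocalRing L v)).val - 1) ^ 2 = 0)} := by
    have h3 := isClosed_setOf_sub_one_pow_eq_zero L v w hsub h2 3
    by_cases hu2 : ((u.val : GL (Fin 3) (UnitaryGroup.LocalRing L v)).val - 1) ^ 2 = 0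
    · have : {γ : (cmDatum L 3 (Matrix.of fun i j : Fin 3 => if i.val + j.val + 1 = 3 then (1 : L) else 0)).Local v | ((γ.val : GL (Fin 3) (UnitaryGroup.LocalRing L v)).val - 1) ^ 3 = 0 ∧ (((u.val : GL (Fin 3) (UnitaryGroup.LocalRing L v)).val - 1) ^ 2 = 0 → ((γ.val : GL (Fin 3) (UnitaryGroup.LocalRing L v)).val - 1) ^ 2 = 0)} =
          {γ : (cmDatum L 3 (Matrix.of fun i j : Fin 3 => if i.val + j.val + 1 = 3 then (1 : L) else 0)).Local v | ((γ.val : GL (Fin 3) (UnitaryGroup.LocalRing L v)).val - 1) ^ 3 = 0} ∩ {γ : (cmDatum L 3 (Matrix.of fun i j : Fin 3 => if i.val + j.val + 1 = 3 then (1 : L) else 0)).Local v | ((γ.val : GL (Fin 3) (UnitaryGroup.LocalRing L v)).val - 1) ^ 2 = 0} := by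
        ext γ; simp only [Set.mem_setOf_eq, Set.mem_inter_iff, hu2, forall_const]
      rw [this]; exact h3.inter (isClosed_setOf_sub_one_pow_eq_zero L v w hsub h2 2)
    · have : {γ : (cmDatum L 3 (Matrix.of fun i j : Fin 3 => if i.val + j.val + 1 = 3 then (1 : L) else 0)).Local v | ((γ.val : GL (Fin 3) (UnitaryGroup.LocalRing L v)).val - 1) ^ 3 = 0 ∧ (((u.val : GL (Fin 3) (UnitaryGroup.LocalRing L v)).val - 1) ^ 2 = 0 → ((γ.val : GL (Fin 3) (UnitaryGroup.LocalRing L v)).val - 1) ^ 2 = 0)} = {γ : (cmDatum L 3 (Matrix.of fun i j : Fin 3 => if i.val + j.val + 1 = 3 then (1 : L) else 0)).Local v | ((γ.val : GL (Fin 3) (UnitaryGroup.LocalRing L v)).val - 1) ^ 3 = 0} := by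
        ext γ; simp only [Set.mem_setOf_eq, hu2, IsEmpty.forall_iff, and_true]
      rw [this]; exact h3
  refine closure_minimal (fun γ hγ => ?_) hclosed
  rw [ConjClasses.mem_carrier_iff_mk_eq, ConjClasses.mk_eq_mk_iff_isConj, isConj_comm] at hγ
  exact ⟨(sub_one_pow_eq_zero_iff_of_isConj L w hw hsub hγ 3).1 hu3, fun hu2 => (sub_one_pow_eq_zero_iff_of_isConj L w hw hsub hγ 2).1 hu2⟩

end Heads

end Literature.NumberTheory.Rogawski1990

end
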